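import Literature.RingTheory.MvPolynomial.RefinedBezoutIsolatedZeros
import Literature.RingTheory.MvPolynomial.IdealHomogenization
import HarnessLib

/-!
# Grid points in the image of a polynomial map: `|F(K^k) ∩ T^n| ≤ (|T| · deg F)^k`
# (Hrubeš–Yehudayoff 2011, Lemma 3.5 / Claim 3.6)

Topic: `Literature/RingTheory/MvPolynomial`. Let `K` be an infinite field,
`F = (F_1, …, F_n) : K^k → K^n` a polynomial map with `deg F_i ≤ d` (`d ≥ 1`) and `T ⊂ K` a finite
non-empty set. Then **the image `F(K^k)` contains at most `(|T| · d)^k` points of the grid `T^n`**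
(`card_piFinset_filter_image_le_pow`; `card_piFinset_filter_image_le_pow_of_field` for every
field `K`). This is [HY11a] Lemma 3.5 ("`|F(𝔽^n) ∩ {0,1}^m| ≤ (2d)^n`")
and the case `V = 𝔸^k`, `r = 1` of its Claim 3.6 ("Let `V ⊆ 𝔽^n` be an irreducible variety of
dimension `k` and degree `r > 0`. Then `|F(V) ∩ {0,1}^m| ≤ r (2d)^k`"), in the form with an
arbitrary finite value set used by Chatterjee–Kumar–Ramya–Saptharishi–Tengse 2020 (‹Lemma 21›,
"`|F(V) ∩ Δ^m| ≤ r · (|Δ| · d)^k`"); it discharges the tree's named fact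
`Literature.Barriers.ValiantsHypothesis.CKRST2020_lemma21_affineSpace`
(`Barriers/ValiantsHypothesis/CKRST20Lemma21Proofs.lean`).

## The proof (the printed induction on the dimension, in ideal form)

[HY11a] prove Claim 3.6 by induction on `k = dim V`: if some `F_i` takes two values on `V`, the
sections `V ∩ {F_i = ε}` are proper, their components have dimension `< k` and, by Bézout's
theorem, total degree `≤ r · d`; summing over `ε` gives `r (2d)^k`; otherwise `F` is constant on
`V`. Here the irreducible varieties are the homogeneous primes `𝔓` of `S = K[X_0, …, X_k]`
(projective closures; affine points live in the chart `X_0 = 1`, `affZero`), the dimension is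
`dim S/𝔓 - 1 = a` and the degree is `a! · lc(P_𝔓)` for the Hilbert polynomial `P_𝔓`
(`Literature.RingTheory.MvPolynomial.exists_hilbertPolynomial`, `natDegree_hilbertPolynomial`:
`deg P_𝔓 = a`, `lc(P_𝔓) ≥ 1/a!`). The statement proved by strong induction on `a`
(`GridImageCount.card_gridImage_le`) is

  `|F(V_aff(𝔓)) ∩ T^n| ≤ a! · lc(P_𝔓) · (|T| d)^a`.

* Leaves (`card_gridImage_le_one`): all `F_i` constant on `V_aff(𝔓)` ⇒ at most one image point,
  and `1 ≤ a! lc(P_𝔓)`.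
* A prime of dimension one has at most one affine point (`affZero_subsingleton`, through the line
  ideals `𝔭_x` of `RefinedBezoutIsolatedZeros.lean`), so a non-constant `F_i` forces `a ≥ 1`.
* Cut (`sum_deg_minimalPrimes_le`): `Q_z`, the degree-`d` homogenization of `F_i - z`
  (`cutPoly`, via `IdealHomogenization.homogenizeTo`), lies outside `𝔓` when `F_i` is not constant
  on `V_aff(𝔓)`; the minimal primes `𝔮` of `𝔓 + (Q_z)` have dimension `a - 1`
  (`ringKrullDim_quotient_add_one_of_mem_minimalPrimes_sup_span`), and Bézout's Lemma in
  leading-coefficient form (`leadingCoeff_hilbertPolynomial_le_of_hypersurface`, applied to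
  `J = 𝔓`, `J' = ⋂ 𝔮`) with the weighted additivity of the degree over equidimensional components
  (`sum_leadingCoeff_hilbPoly_le_coeff`, the weighted form of `card_mul_inv_factorial_le_coeff`)
  gives `Σ_𝔮 deg 𝔮 ≤ d · deg 𝔓`.
* Every image point with `i`-th coordinate `z` comes from an affine zero of some such `𝔮`
  (`exists_minimalPrimes_mem_affZero`), so the count for `𝔓` is at most
  `Σ_{z ∈ T} Σ_𝔮 deg 𝔮 · (|T| d)^{a-1} ≤ |T| · d · deg 𝔓 · (|T| d)^{a-1}`.
* At the zero ideal (`hilbertPolynomial_bot`: `lc = 1/k!`) this is the headline bound.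

Deviation from print: [HY11a] work over an algebraically closed field; the argument above needs
only `K` infinite (the Hilbert-function machinery of the tree), and the bound over an ARBITRARY
field (`card_piFinset_filter_image_le_pow_of_field`; Lemma 3.5 is printed for "a field `𝔽`")
follows, as in print, by extending scalars to the algebraic closure. General irreducible `V` of
degree `r` is `card_gridImage_le` itself, stated with primes and Hilbert polynomials rather than
with a degree of varieties (TODO(general form): the tree has no degree of affine varieties).

## References

* P. Hrubeš, A. Yehudayoff, *Arithmetic complexity in ring extensions*, Theory of Computing 7
  (2011) 119–129, Lemma 3.5 and Claim 3.6 (proof by induction on the dimension with Bézout's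
  theorem). [HrubesYehudayoff2011] locator: paper:doi-10-4086-toc-2011-v007a008 p0006.txt:L51–L63
* P. Chatterjee, M. Kumar, C. Ramya, R. Saptharishi, A. Tengse, *On the existence of algebraically
  natural proofs*, arXiv:2004.14147, v2 ‹Lemma 21› (= ECCC TR20-063 Lemma 4.1).
  [ChatterjeeKumarRamyaSaptharishiTengse2020]
* Yu. V. Nesterenko, P. Philippon (eds.), *Introduction to Algebraic Independence Theory*,
  LNM 1752 (2001), Ch. 11 §2.2 (ii), (iii) (degree, additivity, Bézout's Lemma).
  [NesterenkoPhilippon2001]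
* J. Heintz, *Definability and fast quantifier elimination in algebraically closed fields*,
  Theoret. Comput. Sci. 24 (1983) 239–277, Thm. 1 (Bézout inequality). [Heintz1983]
-/

noncomputable section

open Module Polynomial

attribute [local instance] MvPolynomial.gradedAlgebra

namespace Literature.RingTheory.MvPolynomial

namespace GridImageCount

variable {K : Type*} [Field K] {k : ℕ}

/-! ## The cut polynomials -/

/-- The cut polynomial: the degree-`d` homogenization of `f - z` in `K[X_0, …, X_k]`
(`X_0` the homogenizing variable, `X_{j+1} ↔ y_j`). [folklore] -/
def cutPoly (d : ℕ) (f : MvPolynomial (Fin k) K) (z : K) : MvPolynomial (Fin (k + 1)) K :=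
  MvPolynomial.rename (finSuccEquiv k).symm
    (IdealHomogenization.homogenizeTo d (f - MvPolynomial.C z))

/-- The cut polynomial is a form of degree `d` (for `deg f ≤ d`). [folklore] -/
private theorem cutPoly_isHomogeneous {d : ℕ} {f : MvPolynomial (Fin k) K} (hf : f.totalDegree ≤ d)
    (z : K) : (cutPoly d f z).IsHomogeneous d := by
  unfold cutPoly
  refine (IdealHomogenization.homogenizeTo_isHomogeneous ?_).rename_isHomogeneous
  refine (MvPolynomial.totalDegree_sub _ _).trans (max_le hf ?_)
  rw [MvPolynomial.totalDegree_C]; exact Nat.zero_le _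

/-- At the affine point `(1 : y)` the cut polynomial takes the value `f(y) - z`. [folklore] -/
private theorem eval_cons_cutPoly (d : ℕ) (f : MvPolynomial (Fin k) K) (z : K) (y : Fin k → K) :
    MvPolynomial.eval (Fin.cons 1 y : Fin (k + 1) → K) (cutPoly d f z) =
      MvPolynomial.eval y f - z := by
  unfold cutPoly
  rw [MvPolynomial.eval_rename]
  have : ((Fin.cons 1 y : Fin (k + 1) → K) ∘ (finSuccEquiv k).symm) =
      fun o : Option (Fin k) => o.elim 1 y := by
    funext o; cases o <;> simp
  rw [this, IdealHomogenization.eval_one_elim, IdealHomogenization.dehomogenization_homogenizeTo,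
    map_sub, MvPolynomial.eval_C]

/-! ## Affine zero sets in the chart `X_0 = 1` and grid points of the image -/

/-- The affine zero set of an ideal of `K[X_0, …, X_k]` in the chart `X_0 = 1`. [folklore] -/
def affZero (I : Ideal (MvPolynomial (Fin (k + 1)) K)) : Set (Fin k → K) :=
  {y | ∀ p ∈ I, MvPolynomial.eval (Fin.cons 1 y : Fin (k + 1) → K) p = 0}

variable {n : ℕ}

open Classical in
/-- The grid points `v ∈ T^n` of the image `F(V_aff(I))`. [folklore] -/
def gridImage (F : Fin n → MvPolynomial (Fin k) K) (T : Finset K)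
    (I : Ideal (MvPolynomial (Fin (k + 1)) K)) : Finset (Fin n → K) :=
  (Fintype.piFinset fun _ : Fin n => T).filter
    fun v => ∃ y ∈ affZero I, ∀ i, MvPolynomial.eval y (F i) = v i

/-- Membership in `gridImage`. [folklore] -/
private theorem mem_gridImage {F : Fin n → MvPolynomial (Fin k) K} {T : Finset K}
    {I : Ideal (MvPolynomial (Fin (k + 1)) K)} {v : Fin n → K} :
    v ∈ gridImage F T I ↔
      (∀ i, v i ∈ T) ∧ ∃ y ∈ affZero I, ∀ i, MvPolynomial.eval y (F i) = v i := by
  classical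
  simp only [gridImage, Finset.mem_filter, Fintype.mem_piFinset]

/-- **Leaves of the induction**: if every `F_i` is constant on `V_aff(I)`, the image has at most
one grid point. [folklore] -/
private theorem card_gridImage_le_one (F : Fin n → MvPolynomial (Fin k) K) (T : Finset K)
    {I : Ideal (MvPolynomial (Fin (k + 1)) K)}
    (h : ∀ i, ∀ y ∈ affZero I, ∀ y' ∈ affZero I,
      MvPolynomial.eval y (F i) = MvPolynomial.eval y' (F i)) :
    (gridImage F T I).card ≤ 1 := by
  refine Finset.card_le_one.mpr fun v hv v' hv' => ?_
  obtain ⟨-, y, hy, hyv⟩ := mem_gridImage.mp hv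
  obtain ⟨-, y', hy', hyv'⟩ := mem_gridImage.mp hv'
  funext i
  rw [← hyv i, ← hyv' i, h i y hy y' hy']

/-! ## Points and primes -/

/-- A homogeneous ideal all of whose members vanish at the affine point `(1 : y)` is contained in
the ideal `𝔭_{(1:y)}` of the line through it. [folklore] -/
private theorem le_ker_lineSubst_of_mem_affZero [Infinite K]
    {I : Ideal (MvPolynomial (Fin (k + 1)) K)}
    (hI : I.IsHomogeneous (MvPolynomial.homogeneousSubmodule (Fin (k + 1)) K)) {y : Fin k → K}
    (hy : y ∈ affZero I) :
    I ≤ RingHom.ker (MvPolynomial.eval₂Hom Polynomial.C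
      (fun i : Fin (k + 1) =>
        Polynomial.C ((Fin.cons 1 y : Fin (k + 1) → K) i) * Polynomial.X)) := by
  intro p hp
  rw [← MvPolynomial.sum_homogeneousComponent p]
  refine Ideal.sum_mem _ fun j _ => ?_
  exact mem_ker_lineSubst_of_isHomogeneous (MvPolynomial.homogeneousComponent_isHomogeneous j p)
    (hy _ (MvPolynomial.homogeneousComponent_mem_of_mem hI hp j))

/-- **A homogeneous prime of dimension one has at most one affine point.** [folklore] -/
private theorem affZero_subsingleton [Infinite K] {𝔓 : Ideal (MvPolynomial (Fin (k + 1)) K)}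
    [𝔓.IsPrime] (h𝔓 : 𝔓.IsHomogeneous (MvPolynomial.homogeneousSubmodule (Fin (k + 1)) K))
    (hdim : ringKrullDim (MvPolynomial (Fin (k + 1)) K ⧸ 𝔓) = (1 : ℕ))
    {y y' : Fin k → K} (hy : y ∈ affZero 𝔓) (hy' : y' ∈ affZero 𝔓) : y = y' := by
  set x : Fin (k + 1) → K := Fin.cons 1 y with hx
  have hx0 : x ≠ 0 := fun h => by
    have := congrFun h 0
    rw [hx, Fin.cons_zero, Pi.zero_apply] at this
    exact one_ne_zero this
  haveI := ker_lineSubst_isPrime x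
  have heq := eq_of_le_of_ringKrullDim_quotient_eq (le_ker_lineSubst_of_mem_affZero h𝔓 hy) hdim
    (ringKrullDim_quotient_ker_lineSubst hx0)
  -- `(1 : y')` is a zero of `𝔭_x`, hence on the line `K·x`
  obtain ⟨t, ht⟩ := exists_eq_smul_of_forall_mem_ker_lineSubst hx0 (y := Fin.cons 1 y')
    (fun p hp => hy' p (heq ▸ hp))
  have h0 : t = 1 := by
    have := congrFun ht 0
    simpa [hx] using this.symm
  funext j
  have hj := congrFun ht j.succ
  simp only [hx, Fin.cons_succ, Pi.smul_apply, smul_eq_mul, h0, one_mul] at hj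
  exact hj.symm

/-- An affine zero of `𝔓` at which `Q` vanishes is an affine zero of some minimal prime of
`𝔓 + (Q)`. [folklore] -/
private theorem exists_minimalPrimes_mem_affZero {𝔓 : Ideal (MvPolynomial (Fin (k + 1)) K)}
    {Q : MvPolynomial (Fin (k + 1)) K} {y : Fin k → K} (hy : y ∈ affZero 𝔓)
    (hQ : MvPolynomial.eval (Fin.cons 1 y : Fin (k + 1) → K) Q = 0) :
    ∃ 𝔮 ∈ (𝔓 ⊔ Ideal.span {Q}).minimalPrimes, y ∈ affZero 𝔮 := by
  set M : Ideal (MvPolynomial (Fin (k + 1)) K) :=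
    RingHom.ker (MvPolynomial.eval (Fin.cons 1 y : Fin (k + 1) → K)) with hM
  haveI : M.IsPrime := RingHom.ker_isPrime _
  have hle : 𝔓 ⊔ Ideal.span {Q} ≤ M := by
    refine sup_le (fun p hp => ?_) ((Ideal.span_singleton_le_iff_mem _).mpr ?_)
    · rw [hM, RingHom.mem_ker]; exact hy p hp
    · rw [hM, RingHom.mem_ker]; exact hQ
  obtain ⟨𝔮, h𝔮, h𝔮M⟩ := Ideal.exists_minimalPrimes_le hle
  exact ⟨𝔮, h𝔮, fun p hp => by have := h𝔮M hp; rwa [hM, RingHom.mem_ker] at this⟩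


/-! ## Hilbert polynomials and the weighted additivity of the degree -/

open Classical in
/-- A Hilbert polynomial of the ideal `I` of `K[X_0, …, X_k]`: a rational polynomial agreeing with
the Hilbert function `t ↦ dim_K S_t/I_t` for large `t` (`0` if `I` is not homogeneous).
[folklore] -/
def hilbPoly (I : Ideal (MvPolynomial (Fin (k + 1)) K)) : ℚ[X] :=
  if h : I.IsHomogeneous (MvPolynomial.homogeneousSubmodule (Fin (k + 1)) K) then
    (exists_hilbertPolynomial I h).choose else 0

/-- `hilbPoly I` agrees with the Hilbert function of the homogeneous ideal `I` for large `t`.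
[folklore] -/
private theorem hilbPoly_spec {I : Ideal (MvPolynomial (Fin (k + 1)) K)}
    (h : I.IsHomogeneous (MvPolynomial.homogeneousSubmodule (Fin (k + 1)) K)) :
    ∃ t₀ : ℕ, ∀ t, t₀ ≤ t →
      (((Module.finrank K (MvPolynomial.homogeneousSubmodule (Fin (k + 1)) K t) -
          Module.finrank K (idealDegree I t)) : ℕ) : ℚ) = (hilbPoly I).eval (t : ℚ) := by
  unfold hilbPoly
  rw [dif_pos h]
  exact (exists_hilbertPolynomial I h).choose_spec

/-- Two polynomials agreeing with the same Hilbert function for large `t` are equal. [folklore] -/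
private theorem hilbertPolynomial_unique {I : Ideal (MvPolynomial (Fin (k + 1)) K)} {P P' : ℚ[X]}
    {t₀ t₁ : ℕ} (hP : ∀ t, t₀ ≤ t →
      (((Module.finrank K (MvPolynomial.homogeneousSubmodule (Fin (k + 1)) K t) -
          Module.finrank K (idealDegree I t)) : ℕ) : ℚ) = P.eval (t : ℚ))
    (hP' : ∀ t, t₁ ≤ t →
      (((Module.finrank K (MvPolynomial.homogeneousSubmodule (Fin (k + 1)) K t) -
          Module.finrank K (idealDegree I t)) : ℕ) : ℚ) = P'.eval (t : ℚ)) : P = P' := by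
  apply Polynomial.eq_of_infinite_eval_eq
  apply Set.infinite_of_forall_exists_gt
  intro q
  obtain ⟨t, ht⟩ := exists_nat_gt q
  refine ⟨((max t (max t₀ t₁) : ℕ) : ℚ), ?_, ht.trans_le (by exact_mod_cast le_max_left _ _)⟩
  change P.eval _ = P'.eval _
  rw [← hP _ (le_trans (le_max_left _ _) (le_max_right _ _)),
    ← hP' _ (le_trans (le_max_right _ _) (le_max_right _ _))]

/-- **Weighted additivity of the degree over equidimensional components** (LNM 1752 Ch. 11
§2.2 (ii), "`deg I = Σ deg 𝔮_i`", inequality form): for a non-empty finite set `𝓠` of homogeneous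
primes of dimension `a + 1`, the sum of the leading coefficients of the Hilbert polynomials of the
`𝔮 ∈ 𝓠` is at most `coeff_a` of the Hilbert polynomial of `⋂𝓠`.
[cite: NesterenkoPhilippon2001, Ch. 11 §2.2 (ii)] -/
theorem sum_leadingCoeff_hilbPoly_le_coeff [Infinite K] {a : ℕ} :
    ∀ (𝓠 : Finset (Ideal (MvPolynomial (Fin (k + 1)) K))), 𝓠.Nonempty →
      (∀ 𝔮 ∈ 𝓠, 𝔮.IsPrime ∧ 𝔮.IsHomogeneous (MvPolynomial.homogeneousSubmodule (Fin (k + 1)) K) ∧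
        ringKrullDim (MvPolynomial (Fin (k + 1)) K ⧸ 𝔮) = (a + 1 : ℕ)) →
      ∀ (P : ℚ[X]) (t₀ : ℕ), (∀ t, t₀ ≤ t →
        (((Module.finrank K (MvPolynomial.homogeneousSubmodule (Fin (k + 1)) K t) -
          Module.finrank K (idealDegree (𝓠.inf id) t)) : ℕ) : ℚ) = P.eval (t : ℚ)) →
        ∑ 𝔮 ∈ 𝓠, (hilbPoly 𝔮).leadingCoeff ≤ P.coeff a := by
  classical
  intro 𝓠
  induction 𝓠 using Finset.induction_on with
  | empty => intro h; exact absurd h Finset.not_nonempty_empty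
  | insert 𝔮 𝓠 h𝔮𝓠 ih =>
    intro _ h𝓠 P t₀ hP
    obtain ⟨h𝔮prime, h𝔮hom, h𝔮dim⟩ := h𝓠 𝔮 (Finset.mem_insert_self _ _)
    haveI := h𝔮prime
    have h𝓠' : ∀ 𝔮' ∈ 𝓠, 𝔮'.IsPrime ∧
        𝔮'.IsHomogeneous (MvPolynomial.homogeneousSubmodule (Fin (k + 1)) K) ∧
        ringKrullDim (MvPolynomial (Fin (k + 1)) K ⧸ 𝔮') = (a + 1 : ℕ) :=
      fun 𝔮' h𝔮' => h𝓠 𝔮' (Finset.mem_insert_of_mem h𝔮')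
    -- the Hilbert polynomial of `𝔮` alone
    obtain ⟨t₁, hP𝔮⟩ := hilbPoly_spec h𝔮hom
    have hdeg𝔮 := natDegree_hilbertPolynomial h𝔮hom h𝔮dim hP𝔮
    have hlc𝔮 : (hilbPoly 𝔮).coeff a = (hilbPoly 𝔮).leadingCoeff := by
      rw [Polynomial.leadingCoeff, hdeg𝔮.1]
    rw [Finset.sum_insert h𝔮𝓠]
    rcases 𝓠.eq_empty_or_nonempty with h𝓠e | h𝓠ne
    · subst h𝓠e
      rw [Finset.sum_empty, add_zero]
      have e : (insert 𝔮 (∅ : Finset (Ideal (MvPolynomial (Fin (k + 1)) K)))).inf id = 𝔮 := by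
        rw [Finset.inf_insert, Finset.inf_empty]; exact inf_top_eq 𝔮
      rw [e] at hP
      rw [hilbertPolynomial_unique hP hP𝔮, ← hlc𝔮]
    · obtain ⟨Pinf, t₂, hPinf⟩ := exists_hilbertPolynomial (𝓠.inf id) (isHomogeneous_finset_inf
        fun 𝔮' h𝔮' => (h𝓠' 𝔮' h𝔮').2.1)
      have hih := ih h𝓠ne h𝓠' Pinf t₂ hPinf
      obtain ⟨Psup, t₃, hPsup⟩ := exists_hilbertPolynomial (𝔮 ⊔ 𝓠.inf id)
        (h𝔮hom.sup (isHomogeneous_finset_inf fun 𝔮' h𝔮' => (h𝓠' 𝔮' h𝔮').2.1))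
      -- `dim S/(𝔮 + ⋂𝓠) ≤ a` since `⋂𝓠 ⊄ 𝔮`
      have hnle : ¬ 𝓠.inf id ≤ 𝔮 := by
        intro hle
        obtain ⟨𝔮', h𝔮', h𝔮'le⟩ := (Ideal.IsPrime.inf_le' h𝔮prime).mp hle
        haveI := (h𝓠' 𝔮' h𝔮').1
        have heq : 𝔮' = 𝔮 :=
          eq_of_le_of_ringKrullDim_quotient_eq h𝔮'le (h𝓠' 𝔮' h𝔮').2.2 h𝔮dim
        exact h𝔮𝓠 (heq ▸ h𝔮')
      have hsupdim : ringKrullDim (MvPolynomial (Fin (k + 1)) K ⧸ (𝔮 ⊔ 𝓠.inf id)) ≤ a :=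
        ENat.WithBot.lt_add_one_iff.mp (ringKrullDim_quotient_sup_lt_of_not_le h𝔮dim hnle)
      have hcoeff0 : Psup.coeff a = 0 :=
        coeff_hilbertPolynomial_eq_zero_of_ringKrullDim_le
          (h𝔮hom.sup (isHomogeneous_finset_inf fun 𝔮' h𝔮' => (h𝓠' 𝔮' h𝔮').2.1)) hsupdim hPsup
      set T := max (max t₀ t₁) (max t₂ t₃) with hT
      have hadd := coeff_hilbertPolynomial_inf (I := 𝔮) (J := 𝓠.inf id) h𝔮hom
        (isHomogeneous_finset_inf fun 𝔮' h𝔮' => (h𝓠' 𝔮' h𝔮').2.1) (t₀ := T)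
        (fun t ht => hP𝔮 t (by omega)) (fun t ht => hPinf t (by omega))
        (fun t ht => by
          have e : (insert 𝔮 𝓠).inf id = 𝔮 ⊓ 𝓠.inf id := Finset.inf_insert
          rw [← e]; exact hP t (by omega))
        (fun t ht => hPsup t (by omega)) hcoeff0
      rw [hadd, ← hlc𝔮]
      exact add_le_add le_rfl hih

/-! ## The cut step: Bézout's Lemma for the children of a prime -/

/-- **Bézout's inequality for one cut**: for a homogeneous prime `𝔓` of dimension `a + 1 ≥ 2`
with Hilbert polynomial `P` and a form `Q ∉ 𝔓` of degree `d ≥ 1`, the minimal primes `𝔮` of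
`𝔓 + (Q)` (all of dimension `a`) satisfy `Σ_𝔮 (a-1)! · lc(P_𝔮) ≤ d · a! · lc(P)`, i.e.
`Σ deg 𝔮 ≤ d · deg 𝔓`. [cite: NesterenkoPhilippon2001, Ch. 11 §2.2 (iii)] -/
theorem sum_deg_minimalPrimes_le [Infinite K] {a d : ℕ} (ha : 1 ≤ a) (hd : 1 ≤ d)
    {𝔓 : Ideal (MvPolynomial (Fin (k + 1)) K)} [𝔓.IsPrime]
    (h𝔓 : 𝔓.IsHomogeneous (MvPolynomial.homogeneousSubmodule (Fin (k + 1)) K))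
    (hdim : ringKrullDim (MvPolynomial (Fin (k + 1)) K ⧸ 𝔓) = (a + 1 : ℕ))
    {P : ℚ[X]} {t₀ : ℕ} (hP : ∀ t, t₀ ≤ t →
      (((Module.finrank K (MvPolynomial.homogeneousSubmodule (Fin (k + 1)) K t) -
          Module.finrank K (idealDegree 𝔓 t)) : ℕ) : ℚ) = P.eval (t : ℚ))
    {Q : MvPolynomial (Fin (k + 1)) K} (hQ : Q.IsHomogeneous d) (hQ𝔓 : Q ∉ 𝔓)
    (𝓠 : Finset (Ideal (MvPolynomial (Fin (k + 1)) K)))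
    (h𝓠 : ∀ 𝔮, 𝔮 ∈ 𝓠 ↔ 𝔮 ∈ (𝔓 ⊔ Ideal.span {Q}).minimalPrimes) :
    ∑ 𝔮 ∈ 𝓠, (((a - 1).factorial : ℕ) : ℚ) * (hilbPoly 𝔮).leadingCoeff ≤
      (d : ℚ) * ((a.factorial : ℕ) : ℚ) * P.leadingCoeff := by
  classical
  have hPdeg := natDegree_hilbertPolynomial h𝔓 hdim hP
  have hlcpos : 0 < P.leadingCoeff := lt_of_lt_of_le (by positivity) hPdeg.2
  rcases 𝓠.eq_empty_or_nonempty with h𝓠e | h𝓠ne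
  · rw [h𝓠e, Finset.sum_empty]; positivity
  have hQ0 : Q ≠ 0 := fun h => hQ𝔓 (h ▸ Submodule.zero_mem _)
  have hJhom : (𝔓 ⊔ Ideal.span {Q}).IsHomogeneous
      (MvPolynomial.homogeneousSubmodule (Fin (k + 1)) K) :=
    h𝔓.sup (isHomogeneous_span_singleton hQ)
  -- the children: prime, homogeneous, of dimension `a`
  have h𝓠prop : ∀ 𝔮 ∈ 𝓠, 𝔮.IsPrime ∧
      𝔮.IsHomogeneous (MvPolynomial.homogeneousSubmodule (Fin (k + 1)) K) ∧
      ringKrullDim (MvPolynomial (Fin (k + 1)) K ⧸ 𝔮) = (a - 1 + 1 : ℕ) := by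
    intro 𝔮 h𝔮
    have hmin := (h𝓠 𝔮).mp h𝔮
    refine ⟨hmin.1.1, isHomogeneous_of_mem_minimalPrimes hJhom hmin, ?_⟩
    have h := ringKrullDim_quotient_add_one_of_mem_minimalPrimes_sup_span hQ𝔓 hmin
    rw [hdim, Nat.cast_add, Nat.cast_one] at h
    rw [Nat.sub_add_cancel ha]
    exact ENat.WithBot.add_one_cancel.mp h
  -- Hilbert polynomial of `K' = ⋂𝓠`
  have hK'hom : (𝓠.inf id).IsHomogeneous (MvPolynomial.homogeneousSubmodule (Fin (k + 1)) K) :=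
    isHomogeneous_finset_inf fun 𝔮 h𝔮 => (h𝓠prop 𝔮 h𝔮).2.1
  obtain ⟨P', t₁, hP'⟩ := exists_hilbertPolynomial (𝓠.inf id) hK'hom
  have hK'dim : ringKrullDim (MvPolynomial (Fin (k + 1)) K ⧸ 𝓠.inf id) = (a - 1 + 1 : ℕ) :=
    ringKrullDim_quotient_finset_inf h𝓠ne fun 𝔮 h𝔮 => (h𝓠prop 𝔮 h𝔮).2.2
  have hP'deg := natDegree_hilbertPolynomial hK'hom hK'dim hP'
  have hJK' : 𝔓 ⊔ Ideal.span {Q} ≤ 𝓠.inf id :=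
    Finset.le_inf fun 𝔮 h𝔮 => ((h𝓠 𝔮).mp h𝔮).1.2
  have hnzd : ∀ f, Q * f ∈ 𝔓 → f ∈ 𝔓 := fun f hf =>
    ((‹𝔓.IsPrime›).mem_or_mem hf).resolve_left hQ𝔓
  have hlc := leadingCoeff_hilbertPolynomial_le_of_hypersurface h𝔓 hQ0 hQ hnzd hJK'
    (t₀ := max t₀ t₁) (fun t ht => hP t (le_of_max_le_left ht))
    (fun t ht => hP' t (le_of_max_le_right ht)) (by rw [hPdeg.1]; exact ha)
    (by rw [hP'deg.1, hPdeg.1]) hd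
  -- weighted additivity
  have hsum := sum_leadingCoeff_hilbPoly_le_coeff 𝓠 h𝓠ne h𝓠prop P' t₁ hP'
  have hcoeff : P'.coeff (a - 1) = P'.leadingCoeff := by rw [Polynomial.leadingCoeff, hP'deg.1]
  rw [hcoeff] at hsum
  rw [← Finset.mul_sum]
  have hfac : ((a.factorial : ℕ) : ℚ) = (a : ℚ) * (((a - 1).factorial : ℕ) : ℚ) := by
    rw [← Nat.mul_factorial_pred (by omega : a ≠ 0)]; push_cast; ring
  rw [hPdeg.1] at hlc
  calc (((a - 1).factorial : ℕ) : ℚ) * ∑ 𝔮 ∈ 𝓠, (hilbPoly 𝔮).leadingCoeff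
      ≤ (((a - 1).factorial : ℕ) : ℚ) * ((d : ℚ) * (a : ℚ) * P.leadingCoeff) :=
        mul_le_mul_of_nonneg_left (hsum.trans hlc) (by positivity)
    _ = (d : ℚ) * ((a.factorial : ℕ) : ℚ) * P.leadingCoeff := by rw [hfac]; ring

/-! ## The induction on the dimension -/

/-- **[HY11a] Claim 3.6 in ideal form, over any infinite field.** Let `F = (F_1, …, F_n)` be
polynomials of degree `≤ d` (`d ≥ 1`) in `k` variables, `T ⊂ K` finite non-empty, and `𝔓` a
homogeneous prime of `K[X_0, …, X_k]` with `dim S/𝔓 = a + 1` and Hilbert polynomial `P` (so that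
`V(𝔓) ⊂ ℙ^k` has dimension `a` and degree `a! · lc P`). Then the number of points of `T^n` in the
image `F(V_aff(𝔓))` of the affine part `V_aff(𝔓) = V(𝔓) ∩ {X_0 = 1}` is at most
`a! · lc P · (|T| · d)^a`. Printed ([HY11a] Claim 3.6, `K` algebraically closed, `T = {0,1}`):
"Let `V ⊆ 𝔽^n` be an irreducible variety of dimension `k` and degree `r > 0`. Then
`|F(V) ∩ {0,1}^m| ≤ r (2d)^k`"; the proof is the printed induction on the dimension — if every `F_i`
is constant on `V_aff(𝔓)` there is at most one image point; otherwise cut by the hypersurfaces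
`F_i = z`, `z ∈ T`, whose sections have components of dimension `a - 1` and total degree
`≤ d · deg V(𝔓)` by Bézout's inequality.
[cite: HrubesYehudayoff2011, Claim 3.6] -/
theorem card_gridImage_le [Infinite K] {F : Fin n → MvPolynomial (Fin k) K} {T : Finset K}
    {d : ℕ} (hT : T.Nonempty) (hd : 1 ≤ d) (hF : ∀ i, (F i).totalDegree ≤ d) (a : ℕ) :
    ∀ (𝔓 : Ideal (MvPolynomial (Fin (k + 1)) K)), 𝔓.IsPrime →
      𝔓.IsHomogeneous (MvPolynomial.homogeneousSubmodule (Fin (k + 1)) K) →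
      ringKrullDim (MvPolynomial (Fin (k + 1)) K ⧸ 𝔓) = (a + 1 : ℕ) →
      ∀ (P : ℚ[X]) (t₀ : ℕ), (∀ t, t₀ ≤ t →
        (((Module.finrank K (MvPolynomial.homogeneousSubmodule (Fin (k + 1)) K t) -
          Module.finrank K (idealDegree 𝔓 t)) : ℕ) : ℚ) = P.eval (t : ℚ)) →
        ((gridImage F T 𝔓).card : ℚ) ≤
          ((a.factorial : ℕ) : ℚ) * P.leadingCoeff * ((T.card : ℚ) * d) ^ a := by
  classical
  induction a using Nat.strong_induction_on with
  | _ a ih =>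
  intro 𝔓 h𝔓p h𝔓h hdim P t₀ hP
  have hPdeg := natDegree_hilbertPolynomial h𝔓h hdim hP
  have hM1 : (1 : ℚ) ≤ (T.card : ℚ) * d := by
    have h1 : 1 ≤ T.card := hT.card_pos
    have : (1 : ℚ) ≤ T.card := by exact_mod_cast h1
    have : (1 : ℚ) ≤ d := by exact_mod_cast hd
    nlinarith
  have hdeg1 : (1 : ℚ) ≤ ((a.factorial : ℕ) : ℚ) * P.leadingCoeff := by
    have hfpos : (0 : ℚ) < ((a.factorial : ℕ) : ℚ) := by exact_mod_cast Nat.factorial_pos _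
    have := mul_le_mul_of_nonneg_left hPdeg.2 hfpos.le
    rwa [mul_inv_cancel₀ hfpos.ne'] at this
  have hRHS1 : (1 : ℚ) ≤ ((a.factorial : ℕ) : ℚ) * P.leadingCoeff * ((T.card : ℚ) * d) ^ a := by
    have hp : (1 : ℚ) ≤ ((T.card : ℚ) * d) ^ a := one_le_pow₀ hM1
    calc (1 : ℚ) = 1 * 1 := (mul_one 1).symm
      _ ≤ _ := mul_le_mul hdeg1 hp zero_le_one (zero_le_one.trans hdeg1)
  by_cases hconst : ∀ i, ∀ y ∈ affZero 𝔓, ∀ y' ∈ affZero 𝔓,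
      MvPolynomial.eval y (F i) = MvPolynomial.eval y' (F i)
  · -- a leaf: at most one image point
    have h1 := card_gridImage_le_one F T hconst
    calc ((gridImage F T 𝔓).card : ℚ) ≤ 1 := by exact_mod_cast h1
      _ ≤ _ := hRHS1
  · push Not at hconst
    obtain ⟨i, y₁, hy₁, y₂, hy₂, hne⟩ := hconst
    rcases Nat.eq_zero_or_pos a with rfl | ha
    · -- a prime of dimension one has a single affine point
      exact absurd (by rw [affZero_subsingleton h𝔓h (by simpa using hdim) hy₁ hy₂]) hne
    -- the cut by the hypersurfaces `F_i = z`, `z ∈ T`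
    have hQ : ∀ z, cutPoly d (F i) z ∉ 𝔓 := by
      intro z hz
      have h1 := hy₁ _ hz
      have h2 := hy₂ _ hz
      rw [eval_cons_cutPoly, sub_eq_zero] at h1 h2
      exact hne (by rw [h1, h2])
    set 𝓠 : K → Finset (Ideal (MvPolynomial (Fin (k + 1)) K)) := fun z =>
      (Ideal.finite_minimalPrimes_of_isNoetherianRing _
        (𝔓 ⊔ Ideal.span {cutPoly d (F i) z})).toFinset with h𝓠def
    have hmem𝓠 : ∀ z 𝔮, 𝔮 ∈ 𝓠 z ↔ 𝔮 ∈ (𝔓 ⊔ Ideal.span {cutPoly d (F i) z}).minimalPrimes :=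
      fun z 𝔮 => by rw [h𝓠def, Set.Finite.mem_toFinset]
    -- every image point comes from a child
    have hcov : gridImage F T 𝔓 ⊆ T.biUnion fun z => (𝓠 z).biUnion fun 𝔮 => gridImage F T 𝔮 := by
      intro v hv
      obtain ⟨hvT, y, hy, hyv⟩ := mem_gridImage.mp hv
      rw [Finset.mem_biUnion]
      refine ⟨v i, hvT i, ?_⟩
      rw [Finset.mem_biUnion]
      obtain ⟨𝔮, h𝔮, hy𝔮⟩ := exists_minimalPrimes_mem_affZero hy (Q := cutPoly d (F i) (v i))
        (by rw [eval_cons_cutPoly, hyv i, sub_self])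
      exact ⟨𝔮, (hmem𝓠 _ _).mpr h𝔮, mem_gridImage.mpr ⟨hvT, y, hy𝔮, hyv⟩⟩
    -- the children are primes of dimension `a`; induction hypothesis
    have hchild : ∀ z, ∀ 𝔮 ∈ 𝓠 z, ((gridImage F T 𝔮).card : ℚ) ≤
        (((a - 1).factorial : ℕ) : ℚ) * (hilbPoly 𝔮).leadingCoeff *
          ((T.card : ℚ) * d) ^ (a - 1) := by
      intro z 𝔮 h𝔮
      have hmin := (hmem𝓠 z 𝔮).mp h𝔮
      have h𝔮hom : 𝔮.IsHomogeneous (MvPolynomial.homogeneousSubmodule (Fin (k + 1)) K) :=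
        isHomogeneous_of_mem_minimalPrimes
          (h𝔓h.sup (isHomogeneous_span_singleton (cutPoly_isHomogeneous (hF i) z))) hmin
      have h𝔮dim : ringKrullDim (MvPolynomial (Fin (k + 1)) K ⧸ 𝔮) = (a - 1 + 1 : ℕ) := by
        have h := ringKrullDim_quotient_add_one_of_mem_minimalPrimes_sup_span (hQ z) hmin
        rw [hdim, Nat.cast_add, Nat.cast_one] at h
        rw [Nat.sub_add_cancel ha]
        exact ENat.WithBot.add_one_cancel.mp h
      obtain ⟨t₁, hP𝔮⟩ := hilbPoly_spec h𝔮hom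
      exact ih (a - 1) (by omega) 𝔮 hmin.1.1 h𝔮hom h𝔮dim (hilbPoly 𝔮) t₁ hP𝔮
    -- Bézout per value `z`
    have hz : ∀ z ∈ T, ((((𝓠 z).biUnion fun 𝔮 => gridImage F T 𝔮).card : ℕ) : ℚ) ≤
        (d : ℚ) * ((a.factorial : ℕ) : ℚ) * P.leadingCoeff * ((T.card : ℚ) * d) ^ (a - 1) := by
      intro z _
      calc ((((𝓠 z).biUnion fun 𝔮 => gridImage F T 𝔮).card : ℕ) : ℚ)
          ≤ ∑ 𝔮 ∈ 𝓠 z, ((gridImage F T 𝔮).card : ℚ) := by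
            exact_mod_cast Finset.card_biUnion_le
        _ ≤ ∑ 𝔮 ∈ 𝓠 z, (((a - 1).factorial : ℕ) : ℚ) * (hilbPoly 𝔮).leadingCoeff *
              ((T.card : ℚ) * d) ^ (a - 1) := Finset.sum_le_sum (hchild z)
        _ = (∑ 𝔮 ∈ 𝓠 z, (((a - 1).factorial : ℕ) : ℚ) * (hilbPoly 𝔮).leadingCoeff) *
              ((T.card : ℚ) * d) ^ (a - 1) := by rw [Finset.sum_mul]
        _ ≤ ((d : ℚ) * ((a.factorial : ℕ) : ℚ) * P.leadingCoeff) *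
              ((T.card : ℚ) * d) ^ (a - 1) :=
            mul_le_mul_of_nonneg_right (sum_deg_minimalPrimes_le ha hd h𝔓h hdim hP
              (cutPoly_isHomogeneous (hF i) z) (hQ z) (𝓠 z) (hmem𝓠 z)) (by positivity)
    -- total
    calc ((gridImage F T 𝔓).card : ℚ)
        ≤ ((T.biUnion fun z => (𝓠 z).biUnion fun 𝔮 => gridImage F T 𝔮).card : ℕ) := by
          exact_mod_cast Finset.card_le_card hcov
      _ ≤ ∑ z ∈ T, ((((𝓠 z).biUnion fun 𝔮 => gridImage F T 𝔮).card : ℕ) : ℚ) := by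
          exact_mod_cast Finset.card_biUnion_le
      _ ≤ ∑ z ∈ T, (d : ℚ) * ((a.factorial : ℕ) : ℚ) * P.leadingCoeff *
            ((T.card : ℚ) * d) ^ (a - 1) := Finset.sum_le_sum hz
      _ = (T.card : ℚ) * ((d : ℚ) * ((a.factorial : ℕ) : ℚ) * P.leadingCoeff *
            ((T.card : ℚ) * d) ^ (a - 1)) := by rw [Finset.sum_const, nsmul_eq_mul]
      _ = ((a.factorial : ℕ) : ℚ) * P.leadingCoeff * ((T.card : ℚ) * d) ^ a := by
          have hpow : ((T.card : ℚ) * d) ^ a =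
              ((T.card : ℚ) * d) ^ (a - 1) * ((T.card : ℚ) * d) := by
            rw [← pow_succ, Nat.sub_add_cancel ha]
          rw [hpow]; ring

end GridImageCount

open GridImageCount in
open Classical in
/-- **[HY11a] Lemma 3.5 / Claim 3.6 for `V = 𝔸^k`, over any infinite field**: if
`F = (F_1, …, F_n) : K^k → K^n` is a polynomial map of degree `≤ d` (`d ≥ 1`) and `T ⊂ K` is finite
and non-empty, then `|F(K^k) ∩ T^n| ≤ (|T| · d)^k` (printed: `K` algebraically closed, `T = {0,1}`
in Lemma 3.5, `|F(V) ∩ Δ^m| ≤ r (|Δ| d)^k` for `V` irreducible of dimension `k` and degree `r` in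
Claim 3.6 as used by [CKRST20, Lemma 21]; here `V = 𝔸^k`, `r = 1`, from `card_gridImage_le` at the
zero ideal, whose Hilbert polynomial has leading coefficient `1/k!`).
[cite: HrubesYehudayoff2011, Lemma 3.5 and Claim 3.6] -/
theorem card_piFinset_filter_image_le_pow {K : Type*} [Field K] [Infinite K] {k n d : ℕ}
    {F : Fin n → MvPolynomial (Fin k) K} {T : Finset K} (hT : T.Nonempty) (hd : 1 ≤ d)
    (hF : ∀ i, (F i).totalDegree ≤ d) :
    ((Fintype.piFinset fun _ : Fin n => T).filter
        fun v => ∃ y : Fin k → K, ∀ i, MvPolynomial.eval y (F i) = v i).card ≤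
      (T.card * d) ^ k := by
  have heq : ((Fintype.piFinset fun _ : Fin n => T).filter
      fun v => ∃ y : Fin k → K, ∀ i, MvPolynomial.eval y (F i) = v i) =
      gridImage F T (⊥ : Ideal (MvPolynomial (Fin (k + 1)) K)) := by
    ext v
    rw [mem_gridImage, Finset.mem_filter, Fintype.mem_piFinset]
    have hall : ∀ y : Fin k → K, y ∈ affZero (⊥ : Ideal (MvPolynomial (Fin (k + 1)) K)) :=
      fun y p hp => by rw [Ideal.mem_bot.mp hp, map_zero]
    constructor
    · rintro ⟨h1, y, hy⟩; exact ⟨h1, y, hall y, hy⟩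
    · rintro ⟨h1, y, -, hy⟩; exact ⟨h1, y, hy⟩
  rw [heq]
  obtain ⟨P, hP, hPdeg, hPlc⟩ :=
    hilbertPolynomial_bot (K := K) (m := k + 1) (by omega)
  haveI : (⊥ : Ideal (MvPolynomial (Fin (k + 1)) K)).IsPrime := Ideal.isPrime_bot
  have h := card_gridImage_le hT hd hF k ⊥ inferInstance (Ideal.IsHomogeneous.bot _)
    (ringKrullDim_quotient_bot_mvPolynomial) P 0 (fun t _ => hP t)
  rw [hPlc, Nat.add_sub_cancel,
    mul_inv_cancel₀ (by exact_mod_cast (Nat.factorial_pos k).ne' : ((k.factorial : ℕ) : ℚ) ≠ 0),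
    one_mul] at h
  exact_mod_cast h

open Classical in
/-- **[HY11a] Lemma 3.5 / Claim 3.6 for `V = 𝔸^k` over an ARBITRARY field** ("Let `𝔽` be a
field"): `|F(K^k) ∩ T^n| ≤ (|T| · d)^k` for a polynomial map `F : K^k → K^n` of degree `≤ d`
(`d ≥ 1`) and `T ⊂ K` finite non-empty — from the infinite-field case
`card_piFinset_filter_image_le_pow` by extending scalars to the algebraic closure `K̄` (infinite):
`T^n ∩ F(K^k)` embeds into `T^n ∩ F(K̄^k)` (the printed reduction "since `𝔽̄` is algebraically
closed … Claim 3.6 implies the lemma"). [cite: HrubesYehudayoff2011, Lemma 3.5] -/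
theorem card_piFinset_filter_image_le_pow_of_field {K : Type*} [Field K] {k n d : ℕ}
    {F : Fin n → MvPolynomial (Fin k) K} {T : Finset K} (hT : T.Nonempty) (hd : 1 ≤ d)
    (hF : ∀ i, (F i).totalDegree ≤ d) :
    ((Fintype.piFinset fun _ : Fin n => T).filter
        fun v => ∃ y : Fin k → K, ∀ i, MvPolynomial.eval y (F i) = v i).card ≤
      (T.card * d) ^ k := by
  set ι : K →+* AlgebraicClosure K := algebraMap K (AlgebraicClosure K) with hι
  have hιinj : Function.Injective ι := ι.injective
  -- the scalar-extended data
  have hF' : ∀ i, (MvPolynomial.map ι (F i)).totalDegree ≤ d := fun i =>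
    (Finset.sup_mono (MvPolynomial.support_map_subset ι (F i))).trans (hF i)
  have hT' : (T.map ⟨ι, hιinj⟩).Nonempty := by simpa using hT
  have h := card_piFinset_filter_image_le_pow (F := fun i => MvPolynomial.map ι (F i)) hT' hd hF'
  rw [Finset.card_map] at h
  refine le_trans (Finset.card_le_card_of_injOn (fun v => ι ∘ v) ?_ ?_) h
  · intro v hv
    rw [Finset.mem_coe, Finset.mem_filter, Fintype.mem_piFinset] at hv ⊢
    obtain ⟨hvT, y, hy⟩ := hv
    refine ⟨fun i => Finset.mem_map.mpr ⟨v i, hvT i, rfl⟩, fun j => ι (y j), fun i => ?_⟩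
    change MvPolynomial.eval (fun j => ι (y j)) (MvPolynomial.map ι (F i)) = ι (v i)
    rw [MvPolynomial.eval_map, ← hy i, MvPolynomial.eval₂_comp]
    rfl
  · intro v _ v' _ hvv'
    funext i
    exact hιinj (congrFun hvv' i)

end Literature.RingTheory.MvPolynomial

end
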